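import Literature.Topology.FourManifolds.NonSeparatingSpheresSurgeryModel
import Literature.Topology.FourManifolds.PalaisComplementBallCollar
import Literature.Topology.FourManifolds.RadialDiffeomorph
import Literature.Topology.FourManifolds.FramedTubularNbhd
import Literature.Geometry.Manifold.SmoothEmbeddingInverse
import HarnessLib

/-!
# The surgery disc of a non-separating sphere (Budney–Gabai Thm. 3.13, Cerf–Palais step, II)

Fact seat of `Literature.Topology.FourManifolds.BudneyGabai2019_thm_3_13` (`NonSeparatingSpheres.lean`;
R. Budney, D. Gabai, *Knotted 3-balls in `S⁴`*, arXiv:1912.09029 (v2), Thm. 3.13).  After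
`NonSeparatingSpheresDrill.lean` (the sphere is flat over a tube about a dual circle) and
`NonSeparatingSpheresInflation.lean` (the flat tube is inflated to `S¹ × {p₀ ≤ ℓ}`), this file
performs the *attachment of `Sⁿ⁻¹ × D²`* of the source (remark after Thm. 3.12, p. 22: *"attach a
`Sⁿ⁻¹ × D²` to obtain `Sⁿ⁺¹` where the reducing ball is now an `n`-ball `Δ₁` with boundary a
standard `(n-1)`-sphere"*) through the explicit surgery map `Θ` of
`NonSeparatingSpheresSurgeryModel.lean`, and parametrises the resulting `n`-ball `Δ₁` by a disc:

* `Surgery.northPole`, `Surgery.cap` (`σ_N⁻¹ ∘ (4 •)`, filling the cap `{p₀ ≤ 3/5}` with `𝔻ⁿ`),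
  `Surgery.polarCap` (`N = R_N ∘ σ_N⁻¹`, inverse stereographic projection from the south pole,
  `N(2𝔻ⁿ) = {p₀ ≥ 0}`, related to `cap` by the inversion formula `cap (y/‖y‖²) = N y`),
  `Surgery.squash` (`ℝⁿ ↪ B(0, 8)`, the identity on `B(0, 2)`, from the ball contraction of
  `RadialDiffeomorph.lean`), `Surgery.stdDisc` (**the standard disc** `φ' = ι_E ∘ N`,
  `φ'(2𝔻ⁿ) = H̄₊ = {v₁ = 0, v₀ ≥ 0}`, an injective immersion);
* `Surgery.flatDisc f` — for a sphere `f` flat below `ℓ ≥ 255/257`, the disc `w ↦ f⁻¹(1, cap (sq w))`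
  of `Sⁿ` parametrising the preimage of the flat cap; an injective local diffeomorphism
  (`isLocalDiffeomorph_flatDisc`: smooth by `contMDiffOn_invFun_range`, with the explicit smooth
  left inverse `flatDiscInv`, inverse function theorem), covering exactly the points of height
  `≤ 3/5` on `𝔻ⁿ` (`mem_image_flatDisc_closedBall_iff`);
* `eq_of_map_eq_of_flat` — `Θ` is injective on the part of a flat sphere of height `> -ℓ`;
* **`exists_surgeryDisc`** — the main result: Palais' complement-ball theorem with inverted
  two-sided collar (`exists_complementBall_eq_inversion_nhds`, `PalaisComplementBallCollar.lean`;
  Hirsch (1976), Ch. 8, Thm. 3.1) applied to the flat disc gives `D : ℝⁿ → Sⁿ` with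
  `D(B̊ⁿ) = Sⁿ ∖ flatDisc(𝔻ⁿ)` and `D y = flatDisc (y/‖y‖²)` for `‖y‖ ≥ 1`; the **surgery disc**
  `φ = Θ ∘ f ∘ D : ℝⁿ → Sⁿ⁺¹` is then a smooth immersion, injective on `B̄(0, 3)`, equal to the
  standard disc `φ'` for `‖y‖ ≥ 1`, with `φ(2𝔻ⁿ) = Θ(K ∩ {p₀ > 0}) ∪ S_L = Δ₁`.

The sequel thickens `φ` and `φ'` to `(n+1)`-discs of `Sⁿ⁺¹` agreeing near `∂Δ₁ = S_L` and applies
the disc theorem of Cerf–Palais in `Sⁿ⁺¹` (*"there is a diffeomorphism of this sphere taking `Δ₁`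
to a standard `n`-ball fixing `∂Δ₁` pointwise"*).  Everything here is proved; the definitions are
explicit formulas; no named facts are introduced.

## References

* R. Budney, D. Gabai, *Knotted 3-balls in `S⁴`*, arXiv:1912.09029 (v2), §3, Thm. 3.12 and the
  remark following it, proof of Thm. 3.13 (p. 22). [BudneyGabai2019]
* M. W. Hirsch, *Differential Topology*, GTM 33 (1976), Ch. 8 §3, Thm. 3.1. [HirschDT1976]
* R. Palais, *Extending diffeomorphisms*, Proc. AMS 11 (1960), Thm. B. [Palais1960]
-/

noncomputable section

open scoped Manifold ContDiff Topology Real RealInnerProductSpace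
open Set Function Metric Module

/-- Local notation: Euclidean model space. -/
local notation "𝔼 " n:arg => EuclideanSpace ℝ (Fin n)
/-- Local notation: the unit sphere `Sⁿ ⊆ ℝⁿ⁺¹`. -/
local notation "𝕊 " n:arg => (Metric.sphere (0 : EuclideanSpace ℝ (Fin (n + 1))) 1)

namespace Literature.Topology.FourManifolds

namespace BudneyGabai2019_thm_3_13

namespace Surgery

attribute [local instance] fact_finrank_euclideanSpace_succ
attribute [local instance] finrank_real_complex_fact'

variable (n : ℕ)

/-! ### The north pole and the height -/

/-- The north pole `e₀ = (1, 0, …, 0)` of `Sⁿ`. [folklore] -/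
def northPole : 𝕊 n := ⟨EuclideanSpace.single 0 1, by simp [PiLp.norm_single]⟩

/-- Coordinates of the north pole. [folklore] -/
@[simp] theorem coe_northPole : (northPole n : 𝔼 (n + 1)) = EuclideanSpace.single 0 1 := rfl

/-- The height over the equator is the first coordinate: `⟪p, e₀⟫ = p₀`. [folklore] -/
theorem inner_northPole (x : 𝔼 (n + 1)) : ⟪x, (northPole n : 𝔼 (n + 1))⟫ = x 0 := by
  simp [EuclideanSpace.inner_single_right]

/-! ### The round cap parametrisation `cap = σ_N⁻¹ ∘ (4 •)` and the polar cap `N = R_N ∘ σ_N⁻¹` -/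

/-- The **flat cap parametrisation** `cap y = σ_N⁻¹ (4 y)` (inverse stereographic projection from
the north pole, rescaled): `cap 0` is the south pole and `cap(𝔻ⁿ) = {p₀ ≤ 3/5}`. [folklore] -/
def cap (y : 𝔼 n) : 𝕊 n := (stereographic' n (northPole n)).symm ((4 : ℝ) • y)

/-- The **polar cap parametrisation** `N y = R_N (σ_N⁻¹ y)` (inverse stereographic projection
from the south pole, in Mathlib's normalisation): `N 0` is the north pole, `N(2 𝔻ⁿ) = {p₀ ≥ 0}`,
and `N y = cap (y/‖y‖²)` (inversion formula). [folklore] -/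
def polarCap (y : 𝔼 n) : 𝕊 n :=
  poleReflectionSphere (n := n) (northPole n) ((stereographic' n (northPole n)).symm y)

/-- Height of `cap y`: `(cap y)₀ = (16‖y‖² − 4)/(16‖y‖² + 4)`. [folklore] -/
theorem cap_apply_zero (y : 𝔼 n) :
    (cap n y : 𝔼 (n + 1)) 0 = (16 * ‖y‖ ^ 2 - 4) / (16 * ‖y‖ ^ 2 + 4) := by
  rw [← inner_northPole, cap, real_inner_stereographic'_symm_pole, norm_smul, Real.norm_ofNat]
  ring_nf

/-- Height of `N y`: `(N y)₀ = (4 − ‖y‖²)/(4 + ‖y‖²)`. [folklore] -/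
theorem polarCap_apply_zero (y : 𝔼 n) :
    (polarCap n y : 𝔼 (n + 1)) 0 = (4 - ‖y‖ ^ 2) / (4 + ‖y‖ ^ 2) := by
  rw [← inner_northPole, polarCap]
  show ⟪poleReflection (northPole n) _, _⟫ = _
  rw [inner_poleReflection_pole, real_inner_stereographic'_symm_pole, neg_div', neg_sub, add_comm]

/-- `cap` is smooth. [folklore] -/
theorem contMDiff_cap : ContMDiff 𝓘(ℝ, 𝔼 n) (𝓡 n) ∞ (cap n) :=
  (contMDiff_stereographic'_symm (northPole n)).comp (contDiff_const_smul (4 : ℝ)).contMDiff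

/-- `N` is smooth. [folklore] -/
theorem contMDiff_polarCap : ContMDiff 𝓘(ℝ, 𝔼 n) (𝓡 n) ∞ (polarCap n) :=
  (poleReflectionSphere (n := n) (northPole n)).contMDiff.comp
    (contMDiff_stereographic'_symm (northPole n))

/-- **Inversion formula**: `cap (y/‖y‖²) = N y` for `y ≠ 0`. [folklore] -/
theorem cap_inv_eq_polarCap {y : 𝔼 n} (hy : y ≠ 0) :
    cap n ((‖y‖ ^ 2)⁻¹ • y) = polarCap n y := by
  apply Subtype.ext
  rw [cap, polarCap, smul_smul]
  show _ = poleReflection (northPole n) _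
  rw [poleReflection_stereographic'_symm (northPole n) hy, div_eq_mul_inv]

/-- `N` is injective. [folklore] -/
theorem injective_polarCap : Injective (polarCap n) := by
  intro y y' h
  have h1 := congrArg (poleReflectionSphere (n := n) (northPole n)) h
  rw [polarCap, polarCap, poleReflectionSphere_poleReflectionSphere,
    poleReflectionSphere_poleReflectionSphere] at h1
  simpa [stereographic'_stereographic'_symm] using
    congrArg (stereographic' n (northPole n)) h1

/-- `N` has injective differential everywhere (a reflection after the inverse of a chart).
[folklore] -/
theorem mfderiv_polarCap_injective (y : 𝔼 n) :
    Injective (mfderiv 𝓘(ℝ, 𝔼 n) (𝓡 n) (polarCap n) y) := by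
  have hmem : stereographic' n (northPole n) ∈ atlas (𝔼 n) (𝕊 n) := ⟨northPole n, rfl⟩
  have hσ : Injective (mfderiv (𝓡 n) (𝓡 n) (stereographic' n (northPole n)).symm y) :=
    (mdifferentiable_of_mem_atlas (I := 𝓡 n) hmem).symm.mfderiv_injective (by simp)
  set Rf := poleReflectionSphere (n := n) (northPole n) with hRf
  have hR : Injective (mfderiv (𝓡 n) (𝓡 n) Rf ((stereographic' n (northPole n)).symm y)) := by
    exact (Rf.mfderivToContinuousLinearEquiv (by simp)
      ((stereographic' n (northPole n)).symm y)).injective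
  have hchain : mfderiv 𝓘(ℝ, 𝔼 n) (𝓡 n) (polarCap n) y =
      (mfderiv (𝓡 n) (𝓡 n) Rf ((stereographic' n (northPole n)).symm y)).comp
        (mfderiv (𝓡 n) (𝓡 n) (stereographic' n (northPole n)).symm y) :=
    mfderiv_comp y (Rf.contMDiff.mdifferentiableAt (by simp))
      ((contMDiff_stereographic'_symm (northPole n) y).mdifferentiableAt (by simp))
  rw [hchain]
  have key : Injective (⇑(mfderiv (𝓡 n) (𝓡 n) Rf ((stereographic' n (northPole n)).symm y)) ∘
      ⇑(mfderiv (𝓡 n) (𝓡 n) (stereographic' n (northPole n)).symm y)) := hR.comp hσ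
  exact key

/-- `N` maps the closed ball of radius `2` onto the closed northern hemisphere `{p₀ ≥ 0}`.
[folklore] -/
theorem image_polarCap_closedBall :
    polarCap n '' closedBall 0 2 = {p : 𝕊 n | 0 ≤ (p : 𝔼 (n + 1)) 0} := by
  apply Subset.antisymm
  · rintro _ ⟨y, hy, rfl⟩
    rw [mem_closedBall_zero_iff] at hy
    show 0 ≤ (polarCap n y : 𝔼 (n + 1)) 0
    rw [polarCap_apply_zero]
    apply div_nonneg _ (by positivity)
    nlinarith [norm_nonneg y]
  · intro p hp
    have hp : 0 ≤ (p : 𝔼 (n + 1)) 0 := hp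
    -- `p = N y` with `y = σ_N (R_N p)`
    set q := poleReflectionSphere (n := n) (northPole n) p with hq
    have hqN : q ≠ northPole n := by
      intro h
      have h1 : (q : 𝔼 (n + 1)) 0 = 1 := by rw [h]; simp
      have h2 : (q : 𝔼 (n + 1)) 0 = -(p : 𝔼 (n + 1)) 0 := by
        rw [← inner_northPole, ← inner_northPole, hq]
        exact inner_poleReflection_pole (northPole n) _
      have h3 : -1 ≤ (p : 𝔼 (n + 1)) 0 := by
        have := real_inner_le_norm (-(p : 𝔼 (n + 1))) (northPole n : 𝔼 (n + 1))
        rw [norm_neg, norm_eq_of_mem_sphere p, norm_eq_of_mem_sphere (northPole n),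
          inner_neg_left, inner_northPole] at this
        linarith
      linarith
    set y := stereographic' n (northPole n) q with hy
    have hyq : (stereographic' n (northPole n)).symm y = q :=
      stereographic'_symm_apply_of_ne (northPole n) hqN
    have hNy : polarCap n y = p := by
      rw [polarCap, hyq, hq, poleReflectionSphere_poleReflectionSphere]
    refine ⟨y, ?_, hNy⟩
    rw [mem_closedBall_zero_iff]
    have h0 := polarCap_apply_zero n y
    rw [hNy] at h0
    have h4 : 0 ≤ 4 - ‖y‖ ^ 2 := by
      rw [h0] at hp
      exact (div_nonneg_iff.1 hp).elim (fun h ↦ h.1) fun h ↦ by nlinarith [norm_nonneg y, h.2]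
    nlinarith [norm_nonneg y]


/-- The flat cap parametrisation stays below the height `3/5` on the closed unit ball.
[folklore] -/
theorem cap_apply_zero_le {y : 𝔼 n} (hy : ‖y‖ ≤ 1) : (cap n y : 𝔼 (n + 1)) 0 ≤ 3 / 5 := by
  rw [cap_apply_zero, div_le_div_iff₀ (by positivity) (by norm_num)]
  nlinarith [norm_nonneg y]

/-- The flat cap parametrisation stays strictly below the height `255/257` on the ball of radius
`8`. [folklore] -/
theorem cap_apply_zero_lt {y : 𝔼 n} (hy : ‖y‖ < 8) : (cap n y : 𝔼 (n + 1)) 0 < 255 / 257 := by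
  rw [cap_apply_zero, div_lt_div_iff₀ (by positivity) (by norm_num)]
  nlinarith [norm_nonneg y]

/-- `cap y` is never the north pole. [folklore] -/
theorem cap_ne_northPole (y : 𝔼 n) : cap n y ≠ northPole n :=
  stereographic'_symm_ne (northPole n) _

/-- `σ_N (cap y) = 4 y`. [folklore] -/
theorem stereographic'_cap (y : 𝔼 n) : stereographic' n (northPole n) (cap n y) = (4 : ℝ) • y :=
  stereographic'_stereographic'_symm (northPole n) _

/-- **The flat cap parametrisation maps the closed unit ball onto the cap `{p₀ ≤ 3/5}`.**
[folklore] -/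
theorem image_cap_closedBall :
    cap n '' closedBall 0 1 = {p : 𝕊 n | (p : 𝔼 (n + 1)) 0 ≤ 3 / 5} := by
  apply Subset.antisymm
  · rintro _ ⟨y, hy, rfl⟩
    exact cap_apply_zero_le n (mem_closedBall_zero_iff.1 hy)
  · intro p hp
    have hp : (p : 𝔼 (n + 1)) 0 ≤ 3 / 5 := hp
    have hpN : p ≠ northPole n := by
      intro h; rw [h] at hp; simp at hp; norm_num at hp
    set x := stereographic' n (northPole n) p with hx
    have hpx : (stereographic' n (northPole n)).symm x = p :=
      stereographic'_symm_apply_of_ne (northPole n) hpN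
    refine ⟨(4 : ℝ)⁻¹ • x, ?_, ?_⟩
    · rw [mem_closedBall_zero_iff, norm_smul, norm_inv, Real.norm_ofNat]
      have h0 : (p : 𝔼 (n + 1)) 0 = (‖x‖ ^ 2 - 4) / (‖x‖ ^ 2 + 4) := by
        rw [← inner_northPole, ← hpx]; exact real_inner_stereographic'_symm_pole _ _
      rw [h0, div_le_div_iff₀ (by positivity) (by norm_num)] at hp
      have hx4 : ‖x‖ ≤ 4 := by nlinarith [norm_nonneg x]
      linarith
    · show cap n ((4 : ℝ)⁻¹ • x) = p
      rw [cap, smul_smul, mul_inv_cancel₀ (by norm_num : (4 : ℝ) ≠ 0), one_smul, hpx]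

/-! ### The squash `ℝⁿ → B(0, 8)`, the identity on `B(0, 2)` -/

/-- **The squash** `sq w = 8 g(4 w)`, `g` the ball contraction of `RadialDiffeomorph.lean`: a
smooth embedding of `ℝⁿ` into the ball `B(0, 8)` which is the identity on `B(0, 2)`. [folklore] -/
def squash (w : 𝔼 n) : 𝔼 n := (8 : ℝ) • ballContraction ((4 : ℝ) • w)

/-- A left inverse of the squash (smooth on `B(0, 8)`). [folklore] -/
def unsquash (v : 𝔼 n) : 𝔼 n := (4 : ℝ)⁻¹ • ballContractionInv ((8 : ℝ)⁻¹ • v)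

/-- The squash is smooth. [folklore] -/
theorem contDiff_squash : ContDiff ℝ ∞ (squash n) :=
  (contDiff_ballContraction.comp (contDiff_const_smul (4 : ℝ))).const_smul (8 : ℝ)

/-- The squash is the identity on `B(0, 2)`. [folklore] -/
theorem squash_eq_self {w : 𝔼 n} (hw : ‖w‖ < 2) : squash n w = w := by
  have h4 : ‖(4 : ℝ) • w‖ < 8 := by
    rw [norm_smul, Real.norm_ofNat]; linarith
  rw [squash, ballContraction_eq_smul_of_norm_lt h4, smul_smul, smul_smul]
  norm_num

/-- The squash lands in `B(0, 8)`. [folklore] -/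
theorem norm_squash_lt (w : 𝔼 n) : ‖squash n w‖ < 8 := by
  rw [squash, norm_smul, Real.norm_ofNat]
  have := norm_ballContraction_lt_one ((4 : ℝ) • w)
  linarith

/-- `unsquash ∘ squash = id`. [folklore] -/
theorem unsquash_squash (w : 𝔼 n) : unsquash n (squash n w) = w := by
  rw [unsquash, squash, smul_smul, inv_mul_cancel₀ (by norm_num : (8 : ℝ) ≠ 0), one_smul,
    ballContractionInv_ballContraction, smul_smul, inv_mul_cancel₀ (by norm_num : (4 : ℝ) ≠ 0),
    one_smul]

/-- The squash is injective. [folklore] -/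
theorem injective_squash : Injective (squash n) :=
  (LeftInverse.injective (unsquash_squash n))

/-- `unsquash` is smooth at the points of the image of the squash. [folklore] -/
theorem contDiffAt_unsquash (w : 𝔼 n) : ContDiffAt ℝ ∞ (unsquash n) (squash n w) := by
  have h1 : ‖(8 : ℝ)⁻¹ • squash n w‖ < 1 := by
    rw [squash, smul_smul, inv_mul_cancel₀ (by norm_num : (8 : ℝ) ≠ 0), one_smul]
    exact norm_ballContraction_lt_one _
  exact ((contDiffAt_ballContractionInv h1).comp _ (contDiff_const_smul _).contDiffAt).const_smul _

/-- **The differential of the squash is invertible** (it has a smooth local left inverse).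
[folklore] -/
theorem injective_fderiv_squash (w : 𝔼 n) : Injective (fderiv ℝ (squash n) w) := by
  have hsq : DifferentiableAt ℝ (squash n) w := (contDiff_squash n).differentiable (by simp) w
  have hun : DifferentiableAt ℝ (unsquash n) (squash n w) :=
    (contDiffAt_unsquash n w).differentiableAt (by simp)
  have hcomp : fderiv ℝ (unsquash n ∘ squash n) w =
      (fderiv ℝ (unsquash n) (squash n w)).comp (fderiv ℝ (squash n) w) := fderiv_comp w hun hsq
  have hid : unsquash n ∘ squash n = id := funext (unsquash_squash n)
  rw [hid, fderiv_id] at hcomp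
  have hinj : Injective ((fderiv ℝ (unsquash n) (squash n w)).comp (fderiv ℝ (squash n) w)) := by
    rw [← hcomp]; exact injective_id
  rw [ContinuousLinearMap.coe_comp] at hinj
  exact hinj.of_comp

/-! ### The standard disc `φ' = ι_E ∘ N` -/

/-- **The standard disc** `φ' = ι_E ∘ N : ℝⁿ → Sⁿ⁺¹`: the polar cap parametrisation of `Sⁿ`
followed by the equatorial inclusion; `φ'(2 𝔻ⁿ)` is the closed half great-sphere
`H̄₊ = {v₁ = 0, v₀ ≥ 0}` — the standard `n`-ball of the Cerf–Palais remark of Budney–Gabai (2019),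
after Thm. 3.12. [folklore] -/
def stdDisc (y : 𝔼 n) : 𝕊 (n + 1) := equator n (polarCap n y)

/-- Unfolding of `stdDisc`. [folklore] -/
theorem stdDisc_apply (y : 𝔼 n) : stdDisc n y = equator n (polarCap n y) := rfl

/-- The standard disc is smooth. [folklore] -/
theorem contMDiff_stdDisc : ContMDiff 𝓘(ℝ, 𝔼 n) (𝓡 (n + 1)) ∞ (stdDisc n) :=
  (contMDiff_equator n).comp (contMDiff_polarCap n)

/-- The standard disc is injective. [folklore] -/
theorem injective_stdDisc : Injective (stdDisc n) :=
  (injective_equator n).comp (injective_polarCap n)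

/-- The standard disc is an immersion. [folklore] -/
theorem mfderiv_stdDisc_injective (y : 𝔼 n) :
    Injective (mfderiv 𝓘(ℝ, 𝔼 n) (𝓡 (n + 1)) (stdDisc n) y) := by
  have hchain : mfderiv 𝓘(ℝ, 𝔼 n) (𝓡 (n + 1)) (equator n ∘ polarCap n) y =
      (mfderiv (𝓡 n) (𝓡 (n + 1)) (equator n) (polarCap n y)).comp
        (mfderiv 𝓘(ℝ, 𝔼 n) (𝓡 n) (polarCap n) y) :=
    mfderiv_comp y ((contMDiff_equator n _).mdifferentiableAt (by simp))
      ((contMDiff_polarCap n y).mdifferentiableAt (by simp))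
  have key : Injective (⇑(mfderiv (𝓡 n) (𝓡 (n + 1)) (equator n) (polarCap n y)) ∘
      ⇑(mfderiv 𝓘(ℝ, 𝔼 n) (𝓡 n) (polarCap n) y)) :=
    (mfderiv_equator_injective n _).comp (mfderiv_polarCap_injective n y)
  have h2 : Injective (mfderiv 𝓘(ℝ, 𝔼 n) (𝓡 (n + 1)) (equator n ∘ polarCap n) y) := by
    rw [hchain]; exact key
  exact h2

/-- The standard disc lies in the equatorial great sphere `{v₁ = 0}`. [folklore] -/
@[simp] theorem coe_stdDisc_apply_one (y : 𝔼 n) : (stdDisc n y : 𝔼 (n + 1 + 1)) 1 = 0 :=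
  coe_equator_apply_one n _

/-- The height of the standard disc: `(φ' y)₀ = (4 − ‖y‖²)/(4 + ‖y‖²)`. [folklore] -/
theorem coe_stdDisc_apply_zero (y : 𝔼 n) :
    (stdDisc n y : 𝔼 (n + 1 + 1)) 0 = (4 - ‖y‖ ^ 2) / (4 + ‖y‖ ^ 2) := by
  rw [stdDisc_apply, coe_equator_apply_zero, polarCap_apply_zero]

/-- **The standard disc maps `2 𝔻ⁿ` onto the closed half great-sphere `H̄₊ = {v₁ = 0, v₀ ≥ 0}`.**
[folklore] -/
theorem image_stdDisc_closedBall :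
    stdDisc n '' closedBall 0 2 =
      {v : 𝕊 (n + 1) | (v : 𝔼 (n + 1 + 1)) 1 = 0 ∧ 0 ≤ (v : 𝔼 (n + 1 + 1)) 0} := by
  have h : stdDisc n '' closedBall 0 2 = equator n '' (polarCap n '' closedBall 0 2) := by
    rw [image_image]; rfl
  rw [h, image_polarCap_closedBall]
  apply Subset.antisymm
  · rintro _ ⟨p, hp, rfl⟩
    exact ⟨coe_equator_apply_one n p, by rwa [coe_equator_apply_zero]⟩
  · rintro v ⟨hv1, hv0⟩
    obtain ⟨p, rfl⟩ : v ∈ range (equator n) := by rw [range_equator]; exact hv1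
    exact ⟨p, by rwa [coe_equator_apply_zero] at hv0, rfl⟩


/-! ### Spheres flat below a latitude: the flat disc embedding -/

section Flat

variable {n}

/-- For a sphere flat below the latitude `ℓ`, every point `(1, p)` with `p₀ ≤ ℓ` lies on it.
[folklore] -/
theorem mem_range_of_flat {f : 𝕊 n → Circle × 𝕊 n} {ℓ : ℝ}
    (hflat : range f ∩ {q | (q.2 : 𝔼 (n + 1)) 0 ≤ ℓ} =
      ({1} : Set Circle) ×ˢ {p : 𝕊 n | (p : 𝔼 (n + 1)) 0 ≤ ℓ})
    {p : 𝕊 n} (hp : (p : 𝔼 (n + 1)) 0 ≤ ℓ) : ((1 : Circle), p) ∈ range f := by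
  have h : ((1 : Circle), p) ∈ ({1} : Set Circle) ×ˢ {p : 𝕊 n | (p : 𝔼 (n + 1)) 0 ≤ ℓ} :=
    ⟨rfl, hp⟩
  rw [← hflat] at h
  exact h.1

/-- For a sphere flat below the latitude `ℓ`, a point of it of height `≤ ℓ` has circle coordinate
`1`. [folklore] -/
theorem fst_eq_one_of_flat {f : 𝕊 n → Circle × 𝕊 n} {ℓ : ℝ}
    (hflat : range f ∩ {q | (q.2 : 𝔼 (n + 1)) 0 ≤ ℓ} =
      ({1} : Set Circle) ×ˢ {p : 𝕊 n | (p : 𝔼 (n + 1)) 0 ≤ ℓ})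
    {q : Circle × 𝕊 n} (hq : q ∈ range f) (h : (q.2 : 𝔼 (n + 1)) 0 ≤ ℓ) : q.1 = 1 := by
  have h' : q ∈ range f ∩ {q | (q.2 : 𝔼 (n + 1)) 0 ≤ ℓ} := ⟨hq, h⟩
  rw [hflat] at h'
  exact h'.1

/-- **The surgery map is injective on the part of a flat sphere above the latitude `-ℓ`.**
If `q, q'` lie on a sphere flat below `ℓ` and have heights `> -ℓ`, then `Θ q = Θ q'` forces
`q = q'` (the only collisions of `Θ` are `Θ (-1, p) = Θ (1, p*)` with `p*₀ = -p₀`, and a point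
`(-1, p)` of the sphere has `p₀ > ℓ`). [folklore] -/
theorem eq_of_map_eq_of_flat {f : 𝕊 n → Circle × 𝕊 n} {ℓ : ℝ} (hℓ : 0 < ℓ)
    (hflat : range f ∩ {q | (q.2 : 𝔼 (n + 1)) 0 ≤ ℓ} =
      ({1} : Set Circle) ×ˢ {p : 𝕊 n | (p : 𝔼 (n + 1)) 0 ≤ ℓ})
    {q q' : Circle × 𝕊 n} (hq : q ∈ range f) (hq' : q' ∈ range f)
    (hqℓ : -ℓ < (q.2 : 𝔼 (n + 1)) 0) (hq'ℓ : -ℓ < (q'.2 : 𝔼 (n + 1)) 0)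
    (h : map n q = map n q') : q = q' := by
  -- the asymmetric half of the argument
  have key : ∀ {a b : Circle × 𝕊 n}, a ∈ range f → b ∈ range f → -ℓ < (a.2 : 𝔼 (n + 1)) 0 →
      (a.2 : 𝔼 (n + 1)) 0 ≤ 0 → map n a = map n b → a = b := by
    intro a b ha hb haℓ ha0 hab
    have ha1 : a.1 = 1 := fst_eq_one_of_flat hflat ha (ha0.trans hℓ.le)
    have hmapa : map n a = equator n a.2 := by
      conv_lhs => rw [show a = (a.1, a.2) from rfl, ha1]
      rfl
    by_cases hb0 : (b.2 : 𝔼 (n + 1)) 0 ≤ 0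
    · have hb1 : b.1 = 1 := fst_eq_one_of_flat hflat hb (hb0.trans hℓ.le)
      have hmapb : map n b = equator n b.2 := by
        conv_lhs => rw [show b = (b.1, b.2) from rfl, hb1]
        rfl
      rw [hmapa, hmapb] at hab
      exact Prod.ext (ha1.trans hb1.symm) (injective_equator n hab)
    · push Not at hb0
      have hb' : map n (b.1, b.2) = equator n a.2 := by rw [← hmapa, hab]
      rcases map_eq_equator n hb0 hb' with ⟨hb1, hba⟩ | ⟨hb1, hba⟩
      · exact absurd (hba ▸ hb0) (not_lt.2 ha0)
      · -- `b = (-1, p)` lies above the latitude `ℓ`, so `a₀ = -b₀ < -ℓ`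
        have hbℓ : ℓ < (b.2 : 𝔼 (n + 1)) 0 := by
          by_contra hle
          push Not at hle
          have := fst_eq_one_of_flat hflat hb hle
          rw [hb1] at this
          exact absurd this (by
            intro h1
            have := congrArg (fun u : Circle ↦ (u : ℂ)) h1
            norm_num at this)
        linarith
  by_cases ha0 : (q.2 : 𝔼 (n + 1)) 0 ≤ 0
  · exact key hq hq' hqℓ ha0 h
  by_cases hb0 : (q'.2 : 𝔼 (n + 1)) 0 ≤ 0
  · exact (key hq' hq hq'ℓ hb0 h.symm).symm
  push Not at ha0 hb0
  exact injOn_map n ha0 hb0 h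

/-- The spheres `Sⁿ` are nonempty (the north pole). [folklore] -/
instance instNonemptySphere (n : ℕ) : Nonempty (𝕊 n) := ⟨northPole n⟩

variable (f : 𝕊 n → Circle × 𝕊 n)

/-- **The flat disc** of a sphere `f` flat below `ℓ ≥ 255/257`: `w ↦ f⁻¹ (1, cap (sq w))`, the
preimage parametrisation of the flat cap `{1} × {p₀ < 255/257}` by `ℝⁿ`, equal to
`f⁻¹ ∘ (1, ·) ∘ cap` on `B(0, 2)`. [folklore] -/
def flatDisc (w : 𝔼 n) : 𝕊 n := invFun f ((1 : Circle), cap n (squash n w))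

/-- A left inverse of the flat disc: `x ↦ unsquash (σ_N (pr₂ (f x)) / 4)`. [folklore] -/
def flatDiscInv (x : 𝕊 n) : 𝔼 n :=
  unsquash n ((4 : ℝ)⁻¹ • stereographic' n (northPole n) (f x).2)

variable {f} {ℓ : ℝ} (hf : Manifold.IsSmoothEmbedding (𝓡 n) ((𝓡 1).prod (𝓡 n)) ∞ f)
  (hℓ : 255 / 257 ≤ ℓ)
  (hflat : range f ∩ {q | (q.2 : 𝔼 (n + 1)) 0 ≤ ℓ} =
    ({1} : Set Circle) ×ˢ {p : 𝕊 n | (p : 𝔼 (n + 1)) 0 ≤ ℓ})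

include hℓ hflat in
/-- `f (flatDisc w) = (1, cap (sq w))`. [folklore] -/
theorem apply_flatDisc (w : 𝔼 n) : f (flatDisc f w) = ((1 : Circle), cap n (squash n w)) := by
  apply Function.invFun_eq
  exact mem_range_of_flat hflat ((cap_apply_zero_lt n (norm_squash_lt n w)).le.trans hℓ)

include hℓ hflat in
/-- `flatDiscInv ∘ flatDisc = id`. [folklore] -/
theorem flatDiscInv_flatDisc (w : 𝔼 n) : flatDiscInv f (flatDisc f w) = w := by
  rw [flatDiscInv, apply_flatDisc hℓ hflat, stereographic'_cap, smul_smul,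
    inv_mul_cancel₀ (by norm_num : (4 : ℝ) ≠ 0), one_smul, unsquash_squash]

include hℓ hflat in
/-- The flat disc is injective. [folklore] -/
theorem injective_flatDisc : Injective (flatDisc f) :=
  LeftInverse.injective (flatDiscInv_flatDisc hℓ hflat)

include hf hℓ hflat in
/-- The flat disc is smooth: `f⁻¹` is smooth on the range of `f`
(`Literature.Geometry.Manifold.contMDiffOn_invFun_range`). [folklore] -/
theorem contMDiff_flatDisc : ContMDiff 𝓘(ℝ, 𝔼 n) (𝓡 n) ∞ (flatDisc f) := by
  have hinv := Literature.Geometry.Manifold.contMDiffOn_invFun_range hf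
  have hg : ContMDiff 𝓘(ℝ, 𝔼 n) ((𝓡 1).prod (𝓡 n)) ∞
      (fun w : 𝔼 n ↦ (((1 : Circle), cap n (squash n w)) : Circle × 𝕊 n)) :=
    contMDiff_const.prodMk ((contMDiff_cap n).comp (contDiff_squash n).contMDiff)
  exact hinv.comp_contMDiff hg fun w ↦
    mem_range_of_flat hflat ((cap_apply_zero_lt n (norm_squash_lt n w)).le.trans hℓ)

include hf in
/-- The left inverse of the flat disc is smooth at the points of the flat disc. [folklore] -/
theorem contMDiffAt_flatDiscInv (w : 𝔼 n) (x : 𝕊 n) (hx : f x = ((1 : Circle), cap n (squash n w))) :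
    ContMDiffAt (𝓡 n) 𝓘(ℝ, 𝔼 n) ∞ (flatDiscInv f) x := by
  have h2 : ContMDiffAt (𝓡 n) (𝓡 n) ∞ (fun x : 𝕊 n ↦ (f x).2) x :=
    (contMDiff_snd.comp hf.contMDiff).contMDiffAt
  have hne : (f x).2 ≠ northPole n := by rw [hx]; exact cap_ne_northPole n _
  have h3 : ContMDiffAt (𝓡 n) 𝓘(ℝ, 𝔼 n) ∞
      (fun x : 𝕊 n ↦ stereographic' n (northPole n) (f x).2) x :=
    ((contMDiffOn_stereographic' (northPole n)).contMDiffAt (isOpen_ne.mem_nhds hne)).comp x h2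
  have h4 : ContMDiffAt (𝓡 n) 𝓘(ℝ, 𝔼 n) ∞
      (fun x : 𝕊 n ↦ (4 : ℝ)⁻¹ • stereographic' n (northPole n) (f x).2) x :=
    (contDiff_const_smul (4 : ℝ)⁻¹).contMDiff.contMDiffAt.comp x h3
  have h5 : ContDiffAt ℝ ∞ (unsquash n) ((4 : ℝ)⁻¹ • stereographic' n (northPole n) (f x).2) := by
    rw [hx, stereographic'_cap, smul_smul, inv_mul_cancel₀ (by norm_num : (4 : ℝ) ≠ 0), one_smul]
    exact contDiffAt_unsquash n w
  exact h5.contMDiffAt.comp x h4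

include hf hℓ hflat in
/-- **The flat disc is an injective local diffeomorphism** (its differential is injective by the
smooth left inverse, hence invertible by the dimension count; inverse function theorem).
[folklore] -/
theorem isLocalDiffeomorph_flatDisc : IsLocalDiffeomorph 𝓘(ℝ, 𝔼 n) (𝓡 n) ∞ (flatDisc f) := by
  intro w
  have hsm := contMDiff_flatDisc hf hℓ hflat
  have hL : ContMDiffAt (𝓡 n) 𝓘(ℝ, 𝔼 n) ∞ (flatDiscInv f) (flatDisc f w) :=
    contMDiffAt_flatDiscInv hf w _ (apply_flatDisc hℓ hflat w)
  have hchain : mfderiv 𝓘(ℝ, 𝔼 n) 𝓘(ℝ, 𝔼 n) (flatDiscInv f ∘ flatDisc f) w =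
      (mfderiv (𝓡 n) 𝓘(ℝ, 𝔼 n) (flatDiscInv f) (flatDisc f w)).comp
        (mfderiv 𝓘(ℝ, 𝔼 n) (𝓡 n) (flatDisc f) w) :=
    mfderiv_comp w (hL.mdifferentiableAt (by simp)) ((hsm w).mdifferentiableAt (by simp))
  have hid : flatDiscInv f ∘ flatDisc f = id := funext (flatDiscInv_flatDisc hℓ hflat)
  rw [hid, mfderiv_id] at hchain
  have hinj : Injective (mfderiv 𝓘(ℝ, 𝔼 n) (𝓡 n) (flatDisc f) w) := by
    have h1 : Injective ((mfderiv (𝓡 n) 𝓘(ℝ, 𝔼 n) (flatDiscInv f) (flatDisc f w)).comp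
        (mfderiv 𝓘(ℝ, 𝔼 n) (𝓡 n) (flatDisc f) w)) := by
      rw [← hchain]; exact injective_id
    rw [ContinuousLinearMap.coe_comp] at h1
    exact h1.of_comp
  -- dimension count
  set Df : 𝔼 n →L[ℝ] 𝔼 n := mfderiv 𝓘(ℝ, 𝔼 n) (𝓡 n) (flatDisc f) w with hDf
  let L : 𝔼 n ≃L[ℝ] 𝔼 n :=
    ((Df : 𝔼 n →ₗ[ℝ] 𝔼 n).linearEquivOfInjective hinj rfl).toContinuousLinearEquiv
  refine isLocalDiffeomorphAt_of_mfderiv isOpen_univ (mem_univ w) hsm.contMDiffOn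
    (by exact_mod_cast le_top) L ?_
  ext1 v
  rfl

include hf hℓ hflat in
/-- The flat disc as a globally defined partial diffeomorphism `ℝⁿ → Sⁿ` (an open embedding
with smooth inverse on its open image). [folklore] -/
theorem exists_openPartialHomeomorph_flatDisc :
    ∃ e : OpenPartialHomeomorph (𝔼 n) (𝕊 n), ⇑e = flatDisc f ∧ e.source = univ ∧
      ContMDiffOn 𝓘(ℝ, 𝔼 n) (𝓡 n) ∞ e e.source ∧ ContMDiffOn (𝓡 n) 𝓘(ℝ, 𝔼 n) ∞ e.symm e.target := by
  have hld := isLocalDiffeomorph_flatDisc hf hℓ hflat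
  have hemb : Topology.IsOpenEmbedding (flatDisc f) :=
    hld.isLocalHomeomorph.isOpenEmbedding_of_injective (injective_flatDisc hℓ hflat)
  set e := hemb.toOpenPartialHomeomorph (flatDisc f) with he
  have hea : ⇑e = flatDisc f := hemb.toOpenPartialHomeomorph_apply _
  have hes : e.source = univ := hemb.toOpenPartialHomeomorph_source _
  have het : e.target = range (flatDisc f) := hemb.toOpenPartialHomeomorph_target _
  refine ⟨e, hea, hes, ?_, ?_⟩
  · rw [hea, hes]; exact (contMDiff_flatDisc hf hℓ hflat).contMDiffOn
  · rw [het]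
    rintro _ ⟨w, rfl⟩
    have hsymm : ∀ w, e.symm (flatDisc f w) = w := fun w ↦ hemb.toOpenPartialHomeomorph_left_inv
    have hcongr : ∀ x ∈ range (flatDisc f), e.symm x = flatDiscInv f x := by
      rintro _ ⟨w', rfl⟩
      rw [hsymm, flatDiscInv_flatDisc hℓ hflat]
    exact ((contMDiffAt_flatDiscInv hf w _ (apply_flatDisc hℓ hflat w)).contMDiffWithinAt).congr
      (fun x hx ↦ hcongr x hx) (hcongr _ ⟨w, rfl⟩)

include hℓ hflat in
/-- **Which points the flat disc covers**: `x ∈ flatDisc(𝔻ⁿ)` iff the height of `f x` is at most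
`3/5` (on `𝔻ⁿ ⊆ B(0, 2)` the squash is the identity and `cap(𝔻ⁿ) = {p₀ ≤ 3/5}`). [folklore] -/
theorem mem_image_flatDisc_closedBall_iff (hfi : Injective f) (x : 𝕊 n) :
    x ∈ flatDisc f '' closedBall 0 1 ↔ ((f x).2 : 𝔼 (n + 1)) 0 ≤ 3 / 5 := by
  constructor
  · rintro ⟨w, hw, rfl⟩
    rw [mem_closedBall_zero_iff] at hw
    rw [apply_flatDisc hℓ hflat, squash_eq_self n (by linarith)]
    exact cap_apply_zero_le n hw
  · intro hx
    have hx1 : (f x).1 = 1 := fst_eq_one_of_flat hflat ⟨x, rfl⟩ (hx.trans (by linarith))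
    obtain ⟨w, hw, hwx⟩ : (f x).2 ∈ cap n '' closedBall 0 1 := by
      rw [image_cap_closedBall]; exact hx
    refine ⟨w, hw, hfi ?_⟩
    rw [apply_flatDisc hℓ hflat, squash_eq_self n (by
      linarith [mem_closedBall_zero_iff.1 hw]), hwx]
    exact Prod.ext hx1.symm rfl

end Flat


/-! ### The surgery disc `φ = Θ ∘ f ∘ D` -/

section SurgeryDisc

variable {n} {f : 𝕊 n → Circle × 𝕊 n} {ℓ : ℝ}
  (hf : Manifold.IsSmoothEmbedding (𝓡 n) ((𝓡 1).prod (𝓡 n)) ∞ f)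
  (hℓ : 255 / 257 ≤ ℓ)
  (hflat : range f ∩ {q | (q.2 : 𝔼 (n + 1)) 0 ≤ ℓ} =
    ({1} : Set Circle) ×ˢ {p : 𝕊 n | (p : 𝔼 (n + 1)) 0 ≤ ℓ})
  {D : 𝔼 n → 𝕊 n} (hDs : ContMDiff 𝓘(ℝ, 𝔼 n) (𝓡 n) ∞ D)
  (hDimm : ∀ y, Injective (mfderiv 𝓘(ℝ, 𝔼 n) (𝓡 n) D y)) (hDinj : Injective D)
  (hDcol : ∀ y : 𝔼 n, 1 ≤ ‖y‖ → D y = flatDisc f ((‖y‖ ^ 2)⁻¹ • y))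
  (hDball : D '' ball 0 1 = (flatDisc f '' closedBall 0 1)ᶜ)

include hℓ hflat hDcol in
/-- **On and outside the unit sphere the complementary disc is the flat polar cap**:
`f (D y) = (1, N y)` for `‖y‖ ≥ 1`. [folklore] -/
theorem apply_D_eq {y : 𝔼 n} (hy : 1 ≤ ‖y‖) : f (D y) = ((1 : Circle), polarCap n y) := by
  have hy0 : y ≠ 0 := by
    rintro rfl; rw [norm_zero] at hy; exact absurd hy (by norm_num)
  have hnorm : ‖(‖y‖ ^ 2)⁻¹ • y‖ < 2 := by
    rw [norm_inv_sq_smul]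
    calc ‖y‖⁻¹ ≤ 1 := inv_le_one_of_one_le₀ hy
      _ < 2 := by norm_num
  rw [hDcol y hy, apply_flatDisc hℓ hflat, squash_eq_self n hnorm, cap_inv_eq_polarCap n hy0]

include hℓ hflat hDcol in
/-- On and outside the unit sphere the surgery disc is the standard disc:
`Θ (f (D y)) = φ' y` for `‖y‖ ≥ 1`. [folklore] -/
theorem map_apply_D_eq_stdDisc {y : 𝔼 n} (hy : 1 ≤ ‖y‖) : map n (f (D y)) = stdDisc n y := by
  rw [apply_D_eq hℓ hflat hDcol hy]; rfl

include hℓ hflat hDball in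
/-- Inside the unit ball the complementary disc is high: the height of `f (D y)` exceeds `3/5`
for `‖y‖ < 1`. [folklore] -/
theorem height_apply_D_gt (hfi : Injective f) {y : 𝔼 n} (hy : ‖y‖ < 1) :
    3 / 5 < ((f (D y)).2 : 𝔼 (n + 1)) 0 := by
  have hmem : D y ∈ D '' ball 0 1 := mem_image_of_mem D (mem_ball_zero_iff.2 hy)
  rw [hDball] at hmem
  by_contra h
  push Not at h
  exact hmem ((mem_image_flatDisc_closedBall_iff hℓ hflat hfi (D y)).2 h)

include hf hℓ hflat hDs hDimm in
/-- **The surgery disc is an immersion.**  Over the open solid torus `{p₀ > 0}` it is a composite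
of immersions (`mfderiv_map_injective`); near a point mapped below the latitude `ℓ` the sphere
is flat, `f ∘ D = (1, ψ)` locally, so the surgery disc is `ι_E ∘ ψ` there with `ψ` an immersion.
[folklore] -/
theorem mfderiv_surgeryDisc_injective (y : 𝔼 n) :
    Injective (mfderiv 𝓘(ℝ, 𝔼 n) (𝓡 (n + 1)) (fun y ↦ map n (f (D y))) y) := by
  have hfi : Injective f := hf.isEmbedding.injective
  -- `f ∘ D` is an immersion
  have hfD : Injective (mfderiv 𝓘(ℝ, 𝔼 n) ((𝓡 1).prod (𝓡 n)) (f ∘ D) y) := by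
    obtain ⟨F, _, _, hF⟩ := hf.isImmersion
    have hfimm : Injective (mfderiv (𝓡 n) ((𝓡 1).prod (𝓡 n)) f (D y)) :=
      Manifold.IsImmersionAtOfComplement.mfderiv_injective (hF (D y)) (by simp)
    have hchain : mfderiv 𝓘(ℝ, 𝔼 n) ((𝓡 1).prod (𝓡 n)) (f ∘ D) y =
        (mfderiv (𝓡 n) ((𝓡 1).prod (𝓡 n)) f (D y)).comp (mfderiv 𝓘(ℝ, 𝔼 n) (𝓡 n) D y) :=
      mfderiv_comp y (hf.contMDiff.mdifferentiableAt (by simp)) ((hDs y).mdifferentiableAt (by simp))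
    rw [hchain]
    have key : Injective (⇑(mfderiv (𝓡 n) ((𝓡 1).prod (𝓡 n)) f (D y)) ∘
        ⇑(mfderiv 𝓘(ℝ, 𝔼 n) (𝓡 n) D y)) := hfimm.comp (hDimm y)
    exact key
  have hfDs : ContMDiff 𝓘(ℝ, 𝔼 n) ((𝓡 1).prod (𝓡 n)) ∞ (f ∘ D) := hf.contMDiff.comp hDs
  by_cases h0 : 0 < ((f (D y)).2 : 𝔼 (n + 1)) 0
  · -- over the open solid torus
    have hchain : mfderiv 𝓘(ℝ, 𝔼 n) (𝓡 (n + 1)) (map n ∘ (f ∘ D)) y =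
        (mfderiv ((𝓡 1).prod (𝓡 n)) (𝓡 (n + 1)) (map n) (f (D y))).comp
          (mfderiv 𝓘(ℝ, 𝔼 n) ((𝓡 1).prod (𝓡 n)) (f ∘ D) y) :=
      mfderiv_comp y ((contMDiff_map n).mdifferentiableAt (by simp))
        ((hfDs y).mdifferentiableAt (by simp))
    have key : Injective (⇑(mfderiv ((𝓡 1).prod (𝓡 n)) (𝓡 (n + 1)) (map n) (f (D y))) ∘
        ⇑(mfderiv 𝓘(ℝ, 𝔼 n) ((𝓡 1).prod (𝓡 n)) (f ∘ D) y)) :=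
      (mfderiv_map_injective n h0).comp hfD
    have h2 : Injective (mfderiv 𝓘(ℝ, 𝔼 n) (𝓡 (n + 1)) (map n ∘ (f ∘ D)) y) := by
      rw [hchain]; exact key
    exact h2
  · -- near a flat point: `f ∘ D = (1, ψ)` on the open set `{height < ℓ}`
    push Not at h0
    set ψ : 𝔼 n → 𝕊 n := fun y ↦ (f (D y)).2 with hψ
    have hψs : ContMDiff 𝓘(ℝ, 𝔼 n) (𝓡 n) ∞ ψ := contMDiff_snd.comp hfDs
    have hW : IsOpen {y' : 𝔼 n | ((f (D y')).2 : 𝔼 (n + 1)) 0 < ℓ} :=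
      isOpen_lt ((EuclideanSpace.proj (0 : Fin (n + 1))).continuous.comp
        (continuous_subtype_val.comp hψs.continuous)) continuous_const
    have hyW : y ∈ {y' : 𝔼 n | ((f (D y')).2 : 𝔼 (n + 1)) 0 < ℓ} :=
      h0.trans_lt (by linarith)
    have hev : (f ∘ D) =ᶠ[𝓝 y] fun y' ↦ (((1 : Circle), ψ y') : Circle × 𝕊 n) := by
      filter_upwards [hW.mem_nhds hyW] with y' hy'
      have h1 : (f (D y')).1 = 1 := fst_eq_one_of_flat hflat ⟨D y', rfl⟩ (le_of_lt hy')
      exact Prod.ext h1 rfl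
    have hev' : (fun y' ↦ map n (f (D y'))) =ᶠ[𝓝 y] (equator n ∘ ψ) := by
      filter_upwards [hev] with y' hy'
      show map n ((f ∘ D) y') = equator n (ψ y')
      rw [hy']; rfl
    -- `ψ` is an immersion at `y`
    have hstd : MDifferentiableAt (𝓡 n) ((𝓡 1).prod (𝓡 n))
        (fun p : 𝕊 n ↦ (((1 : Circle), p) : Circle × 𝕊 n)) (ψ y) :=
      ((contMDiff_const.prodMk contMDiff_id : ContMDiff (𝓡 n) ((𝓡 1).prod (𝓡 n)) ∞
        (fun p : 𝕊 n ↦ (((1 : Circle), p) : Circle × 𝕊 n))) _).mdifferentiableAt (by simp)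
    have hchain1 : mfderiv 𝓘(ℝ, 𝔼 n) ((𝓡 1).prod (𝓡 n))
        ((fun p : 𝕊 n ↦ (((1 : Circle), p) : Circle × 𝕊 n)) ∘ ψ) y =
        (mfderiv (𝓡 n) ((𝓡 1).prod (𝓡 n)) (fun p : 𝕊 n ↦ (((1 : Circle), p) : Circle × 𝕊 n))
          (ψ y)).comp (mfderiv 𝓘(ℝ, 𝔼 n) (𝓡 n) ψ y) :=
      mfderiv_comp y hstd ((hψs y).mdifferentiableAt (by simp))
    have hψimm : Injective (mfderiv 𝓘(ℝ, 𝔼 n) (𝓡 n) ψ y) := by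
      have h1 : mfderiv 𝓘(ℝ, 𝔼 n) ((𝓡 1).prod (𝓡 n)) (f ∘ D) y =
          mfderiv 𝓘(ℝ, 𝔼 n) ((𝓡 1).prod (𝓡 n))
            ((fun p : 𝕊 n ↦ (((1 : Circle), p) : Circle × 𝕊 n)) ∘ ψ) y := hev.mfderiv_eq
      rw [h1, hchain1] at hfD
      have key : Injective (⇑(mfderiv (𝓡 n) ((𝓡 1).prod (𝓡 n))
          (fun p : 𝕊 n ↦ (((1 : Circle), p) : Circle × 𝕊 n)) (ψ y)) ∘
            ⇑(mfderiv 𝓘(ℝ, 𝔼 n) (𝓡 n) ψ y)) := hfD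
      exact key.of_comp
    have hchain2 : mfderiv 𝓘(ℝ, 𝔼 n) (𝓡 (n + 1)) (equator n ∘ ψ) y =
        (mfderiv (𝓡 n) (𝓡 (n + 1)) (equator n) (ψ y)).comp (mfderiv 𝓘(ℝ, 𝔼 n) (𝓡 n) ψ y) :=
      mfderiv_comp y ((contMDiff_equator n _).mdifferentiableAt (by simp))
        ((hψs y).mdifferentiableAt (by simp))
    rw [hev'.mfderiv_eq, hchain2]
    have key : Injective (⇑(mfderiv (𝓡 n) (𝓡 (n + 1)) (equator n) (ψ y)) ∘
        ⇑(mfderiv 𝓘(ℝ, 𝔼 n) (𝓡 n) ψ y)) := (mfderiv_equator_injective n _).comp hψimm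
    exact key

include hf hℓ hflat hDinj hDcol hDball in
/-- **The surgery disc is injective on the closed ball of radius `3`** (there all points of
`f ∘ D` have height `> -5/13 > -ℓ`, and `eq_of_map_eq_of_flat` applies). [folklore] -/
theorem injOn_surgeryDisc : InjOn (fun y ↦ map n (f (D y))) (closedBall 0 3) := by
  have hfi : Injective f := hf.isEmbedding.injective
  have hheight : ∀ y ∈ closedBall (0 : 𝔼 n) 3, -ℓ < ((f (D y)).2 : 𝔼 (n + 1)) 0 := by
    intro y hy
    rw [mem_closedBall_zero_iff] at hy
    by_cases h1 : 1 ≤ ‖y‖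
    · rw [apply_D_eq hℓ hflat hDcol h1]
      show -ℓ < (polarCap n y : 𝔼 (n + 1)) 0
      rw [polarCap_apply_zero, lt_div_iff₀ (by positivity)]
      nlinarith
    · push Not at h1
      linarith [height_apply_D_gt hℓ hflat hDball hfi h1]
  intro y hy y' hy' h
  have hq := eq_of_map_eq_of_flat (by linarith) hflat ⟨D y, rfl⟩ ⟨D y', rfl⟩ (hheight y hy)
    (hheight y' hy') h
  exact hDinj (hfi hq)

include hf hℓ hflat hDcol hDball in
/-- **The image of `2 𝔻ⁿ` under the surgery disc** is the image under `Θ` of the part of the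
sphere over the open solid torus `{p₀ > 0}`, together with the great sphere `S_L = {z = 0}`:
`φ(2 𝔻ⁿ) = Θ(K ∩ {p₀ > 0}) ∪ S_L` — the `n`-ball `Δ₁` of the Cerf–Palais remark
(Budney–Gabai 2019, after Thm. 3.12). [folklore] -/
theorem image_surgeryDisc_closedBall :
    (fun y ↦ map n (f (D y))) '' closedBall 0 2 =
      map n '' (range f ∩ {q | 0 < (q.2 : 𝔼 (n + 1)) 0}) ∪
        {v : 𝕊 (n + 1) | zc n (v : 𝔼 (n + 1 + 1)) = 0} := by
  have hfi : Injective f := hf.isEmbedding.injective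
  -- norms `1 ≤ ‖y‖ ≤ 2` are exactly the heights `0 ≤ (N y)₀ ≤ 3/5`
  have hnorm_of_height : ∀ y : 𝔼 n, (polarCap n y : 𝔼 (n + 1)) 0 ≤ 3 / 5 → 1 ≤ ‖y‖ := by
    intro y h
    rw [polarCap_apply_zero, div_le_div_iff₀ (by positivity) (by norm_num)] at h
    nlinarith [norm_nonneg y]
  have hzc_eq : ∀ p : 𝕊 n, zc n (equator n p : 𝔼 (n + 1 + 1)) = (((p : 𝔼 (n + 1)) 0 : ℝ) : ℂ) := by
    intro p
    rw [equator, zc_coe_map]; simp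
  apply Subset.antisymm
  · rintro _ ⟨y, hy, rfl⟩
    rw [mem_closedBall_zero_iff] at hy
    show map n (f (D y)) ∈ _
    by_cases h1 : 1 ≤ ‖y‖
    · rw [map_apply_D_eq_stdDisc hℓ hflat hDcol h1, stdDisc_apply]
      have hh : 0 ≤ (polarCap n y : 𝔼 (n + 1)) 0 := by
        rw [polarCap_apply_zero]; apply div_nonneg _ (by positivity); nlinarith
      rcases hh.eq_or_lt with hz | hpos
      · right
        show zc n (equator n (polarCap n y) : 𝔼 (n + 1 + 1)) = 0
        rw [hzc_eq, ← hz, Complex.ofReal_zero]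
      · left
        have hle : (polarCap n y : 𝔼 (n + 1)) 0 ≤ 3 / 5 := by
          rw [polarCap_apply_zero, div_le_div_iff₀ (by positivity) (by norm_num)]
          nlinarith
        exact ⟨((1 : Circle), polarCap n y),
          ⟨mem_range_of_flat hflat (hle.trans (by linarith)), hpos⟩, rfl⟩
    · push Not at h1
      left
      exact ⟨f (D y), ⟨⟨D y, rfl⟩, lt_trans (by norm_num) (height_apply_D_gt hℓ hflat hDball hfi h1)⟩,
        rfl⟩
  · rintro v (⟨q, ⟨⟨x, rfl⟩, hq0⟩, rfl⟩ | hv)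
    · -- a point of the sphere over the open solid torus
      have hq0 : 0 < ((f x).2 : 𝔼 (n + 1)) 0 := hq0
      by_cases h35 : ((f x).2 : 𝔼 (n + 1)) 0 ≤ 3 / 5
      · -- flat and low: `f x = (1, N y)` with `1 ≤ ‖y‖ ≤ 2`
        have hx1 : (f x).1 = 1 := fst_eq_one_of_flat hflat ⟨x, rfl⟩ (h35.trans (by linarith))
        obtain ⟨y, hy2, hyx⟩ : (f x).2 ∈ polarCap n '' closedBall 0 2 := by
          rw [image_polarCap_closedBall]; exact hq0.le
        have hy1 : 1 ≤ ‖y‖ := hnorm_of_height y (by rw [hyx]; exact h35)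
        refine ⟨y, hy2, ?_⟩
        show map n (f (D y)) = map n (f x)
        rw [map_apply_D_eq_stdDisc hℓ hflat hDcol hy1, stdDisc_apply, hyx,
          show f x = ((f x).1, (f x).2) from rfl, hx1]
        rfl
      · -- high: covered by `D(B̊ⁿ)`
        push Not at h35
        have hxm : x ∉ flatDisc f '' closedBall 0 1 := fun hx ↦
          absurd ((mem_image_flatDisc_closedBall_iff hℓ hflat hfi x).1 hx) (not_le.2 h35)
        have hxD : x ∈ D '' ball 0 1 := by rw [hDball]; exact hxm
        obtain ⟨y, hy, rfl⟩ := hxD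
        exact ⟨y, closedBall_subset_closedBall (by norm_num) (ball_subset_closedBall hy), rfl⟩
    · -- a point of the great sphere `S_L`
      have hv : zc n (v : 𝔼 (n + 1 + 1)) = 0 := hv
      have hv0 : (v : 𝔼 (n + 1 + 1)) 0 = 0 := by simpa using congrArg Complex.re hv
      have hv1 : (v : 𝔼 (n + 1 + 1)) 1 = 0 := by simpa using congrArg Complex.im hv
      obtain ⟨p, rfl⟩ : v ∈ range (equator n) := by rw [range_equator]; exact hv1
      rw [coe_equator_apply_zero] at hv0
      obtain ⟨y, hy2, hyp⟩ : p ∈ polarCap n '' closedBall 0 2 := by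
        rw [image_polarCap_closedBall]; exact hv0.ge
      have hy1 : 1 ≤ ‖y‖ := hnorm_of_height y (by rw [hyp, hv0]; norm_num)
      refine ⟨y, hy2, ?_⟩
      show map n (f (D y)) = equator n p
      rw [map_apply_D_eq_stdDisc hℓ hflat hDcol hy1, stdDisc_apply, hyp]

end SurgeryDisc


/-! ### Main theorem of the file -/

section Main

variable {n}

/-- **The surgery disc of a flat non-separating sphere.**  Let `f : Sⁿ → S¹ × Sⁿ` be a smooth
embedding, with image `K`, flat below the latitude `ℓ ∈ [255/257, 1)`:
`K ∩ (S¹ × {p₀ ≤ ℓ}) = {1} × {p₀ ≤ ℓ}`.  Then there is a smooth immersion `φ : ℝⁿ → Sⁿ⁺¹`,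
injective on `B̄(0, 3)`, which agrees with the standard disc `φ' = ι_E ∘ N` on and outside the
unit sphere and maps `2 𝔻ⁿ` onto `Δ₁ = Θ(K ∩ {p₀ > 0}) ∪ S_L`: the reducing ball of `K` read in
the sphere `Sⁿ⁺¹` obtained by surgery, completed by the flat annulus `{1} × {0 < p₀ ≤ 3/5}` and
the great sphere `S_L = ∂Δ₁` — the `n`-ball *"`Δ₁` with boundary a standard `(n-1)`-sphere"* of
Budney–Gabai (2019), remark after Thm. 3.12.  Construction: `φ = Θ ∘ f ∘ D` for the complementary
ball `D` (with inverted two-sided collar, `exists_complementBall_eq_inversion_nhds` = Palais' disc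
theorem in `Sⁿ`) of the flat disc `w ↦ f⁻¹ (1, cap (sq w))`.
[cite: BudneyGabai2019, Thm. 3.12, remark (arXiv:1912.09029 v2, p. 22); HirschDT1976, Ch. 8 Thm. 3.1] -/
theorem exists_surgeryDisc {f : 𝕊 n → Circle × 𝕊 n} {ℓ : ℝ}
    (hf : Manifold.IsSmoothEmbedding (𝓡 n) ((𝓡 1).prod (𝓡 n)) ∞ f) (hℓ : 255 / 257 ≤ ℓ)
    (hflat : range f ∩ {q | (q.2 : 𝔼 (n + 1)) 0 ≤ ℓ} =
      ({1} : Set Circle) ×ˢ {p : 𝕊 n | (p : 𝔼 (n + 1)) 0 ≤ ℓ}) :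
    ∃ φ : 𝔼 n → 𝕊 (n + 1),
      ContMDiff 𝓘(ℝ, 𝔼 n) (𝓡 (n + 1)) ∞ φ ∧
      (∀ y, Injective (mfderiv 𝓘(ℝ, 𝔼 n) (𝓡 (n + 1)) φ y)) ∧
      InjOn φ (closedBall 0 3) ∧
      (∀ y : 𝔼 n, 1 ≤ ‖y‖ → φ y = stdDisc n y) ∧
      φ '' closedBall 0 2 =
        map n '' (range f ∩ {q | 0 < (q.2 : 𝔼 (n + 1)) 0}) ∪
          {v : 𝕊 (n + 1) | zc n (v : 𝔼 (n + 1 + 1)) = 0} := by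
  obtain ⟨e, hea, hes, hesm, hesm'⟩ := exists_openPartialHomeomorph_flatDisc hf hℓ hflat
  obtain ⟨δ, Dp, hδ, -, hDsrc, hD1, hD2, hDcol', -, hDop⟩ :=
    exists_complementBall_eq_inversion_nhds e hes hesm hesm'
  have hmem : ∀ y : 𝔼 n, y ∈ Dp.source := fun y ↦ by rw [hDsrc]; exact mem_univ y
  have hDs : ContMDiff 𝓘(ℝ, 𝔼 n) (𝓡 n) ∞ Dp := by
    rw [← contMDiffOn_univ, ← hDsrc]; exact hD1
  have hDinj : Injective Dp := fun a b h ↦ Dp.injOn (hmem a) (hmem b) h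
  have hDimm : ∀ y, Injective (mfderiv 𝓘(ℝ, 𝔼 n) (𝓡 n) Dp y) := by
    intro y
    have hy : Dp y ∈ Dp.target := Dp.map_source (hmem y)
    have hsymm : ContMDiffAt (𝓡 n) 𝓘(ℝ, 𝔼 n) ∞ Dp.symm (Dp y) :=
      hD2.contMDiffAt (Dp.open_target.mem_nhds hy)
    have hchain : mfderiv 𝓘(ℝ, 𝔼 n) 𝓘(ℝ, 𝔼 n) (Dp.symm ∘ Dp) y =
        (mfderiv (𝓡 n) 𝓘(ℝ, 𝔼 n) Dp.symm (Dp y)).comp (mfderiv 𝓘(ℝ, 𝔼 n) (𝓡 n) Dp y) :=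
      mfderiv_comp y (hsymm.mdifferentiableAt (by simp)) ((hDs y).mdifferentiableAt (by simp))
    have hev : (Dp.symm ∘ Dp) =ᶠ[𝓝 y] id :=
      Filter.Eventually.of_forall fun y' ↦ Dp.left_inv (hmem y')
    rw [hev.mfderiv_eq, mfderiv_id] at hchain
    have h1 : Injective ((mfderiv (𝓡 n) 𝓘(ℝ, 𝔼 n) Dp.symm (Dp y)).comp
        (mfderiv 𝓘(ℝ, 𝔼 n) (𝓡 n) Dp y)) := by
      rw [← hchain]; exact injective_id
    rw [ContinuousLinearMap.coe_comp] at h1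
    exact h1.of_comp
  have hDcol : ∀ y : 𝔼 n, 1 ≤ ‖y‖ → Dp y = flatDisc f ((‖y‖ ^ 2)⁻¹ • y) := fun y hy ↦ by
    rw [← hea]; exact hDcol' y (by linarith)
  have hDball : Dp '' ball 0 1 = (flatDisc f '' closedBall 0 1)ᶜ := by rw [← hea]; exact hDop
  refine ⟨fun y ↦ map n (f (Dp y)), (contMDiff_map n).comp (hf.contMDiff.comp hDs),
    mfderiv_surgeryDisc_injective hf hℓ hflat hDs hDimm,
    injOn_surgeryDisc hf hℓ hflat hDinj hDcol hDball,
    fun y hy ↦ map_apply_D_eq_stdDisc hℓ hflat hDcol hy,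
    image_surgeryDisc_closedBall hf hℓ hflat hDcol hDball⟩

end Main

/-! ### A larger injectivity radius -/

section Twelve

variable {n}

/-- **The surgery disc is injective on the closed ball of radius `12`** (there the heights of
`f ∘ D` are `≥ -35/37 > -ℓ`). [folklore] -/
theorem injOn_surgeryDisc_twelve {f : 𝕊 n → Circle × 𝕊 n} {ℓ : ℝ}
    (hf : Manifold.IsSmoothEmbedding (𝓡 n) ((𝓡 1).prod (𝓡 n)) ∞ f) (hℓ : 255 / 257 ≤ ℓ)
    (hflat : range f ∩ {q | (q.2 : 𝔼 (n + 1)) 0 ≤ ℓ} =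
      ({1} : Set Circle) ×ˢ {p : 𝕊 n | (p : 𝔼 (n + 1)) 0 ≤ ℓ})
    {D : 𝔼 n → 𝕊 n} (hDinj : Injective D)
    (hDcol : ∀ y : 𝔼 n, 1 ≤ ‖y‖ → D y = flatDisc f ((‖y‖ ^ 2)⁻¹ • y))
    (hDball : D '' ball 0 1 = (flatDisc f '' closedBall 0 1)ᶜ) :
    InjOn (fun y ↦ map n (f (D y))) (closedBall 0 12) := by
  have hfi : Injective f := hf.isEmbedding.injective
  have hheight : ∀ y ∈ closedBall (0 : 𝔼 n) 12, -ℓ < ((f (D y)).2 : 𝔼 (n + 1)) 0 := by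
    intro y hy
    rw [mem_closedBall_zero_iff] at hy
    by_cases h1 : 1 ≤ ‖y‖
    · rw [apply_D_eq hℓ hflat hDcol h1]
      show -ℓ < (polarCap n y : 𝔼 (n + 1)) 0
      rw [polarCap_apply_zero, lt_div_iff₀ (by positivity)]
      nlinarith
    · push Not at h1
      linarith [height_apply_D_gt hℓ hflat hDball hfi h1]
  intro y hy y' hy' h
  have hq := eq_of_map_eq_of_flat (by linarith) hflat ⟨D y, rfl⟩ ⟨D y', rfl⟩ (hheight y hy)
    (hheight y' hy') h
  exact hDinj (hfi hq)

/-- **The surgery disc of a flat non-separating sphere**, with injectivity on the closed ball of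
radius `12` (same statement and proof as `exists_surgeryDisc`, larger injectivity radius — the
room needed to thicken the disc with a ball contraction that is linear on `B(0, 8)`).
[cite: BudneyGabai2019, Thm. 3.12, remark (arXiv:1912.09029 v2, p. 22); HirschDT1976, Ch. 8 Thm. 3.1] -/
theorem exists_surgeryDisc_twelve {f : 𝕊 n → Circle × 𝕊 n} {ℓ : ℝ}
    (hf : Manifold.IsSmoothEmbedding (𝓡 n) ((𝓡 1).prod (𝓡 n)) ∞ f) (hℓ : 255 / 257 ≤ ℓ)
    (hflat : range f ∩ {q | (q.2 : 𝔼 (n + 1)) 0 ≤ ℓ} =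
      ({1} : Set Circle) ×ˢ {p : 𝕊 n | (p : 𝔼 (n + 1)) 0 ≤ ℓ}) :
    ∃ φ : 𝔼 n → 𝕊 (n + 1),
      ContMDiff 𝓘(ℝ, 𝔼 n) (𝓡 (n + 1)) ∞ φ ∧
      (∀ y, Injective (mfderiv 𝓘(ℝ, 𝔼 n) (𝓡 (n + 1)) φ y)) ∧
      InjOn φ (closedBall 0 12) ∧
      (∀ y : 𝔼 n, 1 ≤ ‖y‖ → φ y = stdDisc n y) ∧
      φ '' closedBall 0 2 =
        map n '' (range f ∩ {q | 0 < (q.2 : 𝔼 (n + 1)) 0}) ∪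
          {v : 𝕊 (n + 1) | zc n (v : 𝔼 (n + 1 + 1)) = 0} := by
  obtain ⟨e, hea, hes, hesm, hesm'⟩ := exists_openPartialHomeomorph_flatDisc hf hℓ hflat
  obtain ⟨δ, Dp, hδ, -, hDsrc, hD1, hD2, hDcol', -, hDop⟩ :=
    exists_complementBall_eq_inversion_nhds e hes hesm hesm'
  have hmem : ∀ y : 𝔼 n, y ∈ Dp.source := fun y ↦ by rw [hDsrc]; exact mem_univ y
  have hDs : ContMDiff 𝓘(ℝ, 𝔼 n) (𝓡 n) ∞ Dp := by
    rw [← contMDiffOn_univ, ← hDsrc]; exact hD1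
  have hDinj : Injective Dp := fun a b h ↦ Dp.injOn (hmem a) (hmem b) h
  have hDimm : ∀ y, Injective (mfderiv 𝓘(ℝ, 𝔼 n) (𝓡 n) Dp y) := by
    intro y
    have hy : Dp y ∈ Dp.target := Dp.map_source (hmem y)
    have hsymm : ContMDiffAt (𝓡 n) 𝓘(ℝ, 𝔼 n) ∞ Dp.symm (Dp y) :=
      hD2.contMDiffAt (Dp.open_target.mem_nhds hy)
    have hchain : mfderiv 𝓘(ℝ, 𝔼 n) 𝓘(ℝ, 𝔼 n) (Dp.symm ∘ Dp) y =
        (mfderiv (𝓡 n) 𝓘(ℝ, 𝔼 n) Dp.symm (Dp y)).comp (mfderiv 𝓘(ℝ, 𝔼 n) (𝓡 n) Dp y) :=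
      mfderiv_comp y (hsymm.mdifferentiableAt (by simp)) ((hDs y).mdifferentiableAt (by simp))
    have hev : (Dp.symm ∘ Dp) =ᶠ[𝓝 y] id :=
      Filter.Eventually.of_forall fun y' ↦ Dp.left_inv (hmem y')
    rw [hev.mfderiv_eq, mfderiv_id] at hchain
    have h1 : Injective ((mfderiv (𝓡 n) 𝓘(ℝ, 𝔼 n) Dp.symm (Dp y)).comp
        (mfderiv 𝓘(ℝ, 𝔼 n) (𝓡 n) Dp y)) := by
      rw [← hchain]; exact injective_id
    rw [ContinuousLinearMap.coe_comp] at h1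
    exact h1.of_comp
  have hDcol : ∀ y : 𝔼 n, 1 ≤ ‖y‖ → Dp y = flatDisc f ((‖y‖ ^ 2)⁻¹ • y) := fun y hy ↦ by
    rw [← hea]; exact hDcol' y (by linarith)
  have hDball : Dp '' ball 0 1 = (flatDisc f '' closedBall 0 1)ᶜ := by rw [← hea]; exact hDop
  refine ⟨fun y ↦ map n (f (Dp y)), (contMDiff_map n).comp (hf.contMDiff.comp hDs),
    mfderiv_surgeryDisc_injective hf hℓ hflat hDs hDimm,
    injOn_surgeryDisc_twelve hf hℓ hflat hDinj hDcol hDball,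
    fun y hy ↦ map_apply_D_eq_stdDisc hℓ hflat hDcol hy,
    image_surgeryDisc_closedBall hf hℓ hflat hDcol hDball⟩

end Twelve

end Surgery

end BudneyGabai2019_thm_3_13

end Literature.Topology.FourManifolds

end
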